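import Mathlib
import Summits.NavierStokesRegularity.NavierStokesRegularity.Theorems.SubOnsagerCeilingSideBranchChainDrive
import HarnessLib

/-!
# Route SubOnsagerCeiling — signs on the datum shell of the side-branch table `α_SB`
# (helper file for item stmt-NavierStokesRegularity-25507 `OrthantTailCeiling`; `--supports`; def-free)

Fifth brick of the ENGINE for the Onsager-critical escape construction (`SideBranchCriticalEscapeEstimateAt`,
p823602; threshold step p824157): the cascade induction runs along solutions that are non-negative on ALL
shells `≥ 0`, while cone invariance (`OrthantInvariance`, item 25508) only speaks about the shells `≥ 1`.
On the datum shell `0` the equations of `α_SB` are LINEAR in the shell-`0` modes (nothing feeds shell `0`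
from below: `x_{-1} = s_{-1} = 0`), so signs are preserved:

* `sideBranch_linear_sign` — `y' = p − q·y` within `[0,s]` with `p ≥ 0`, `q` continuous, `y(0) ≥ 0`
  `⇒ y ≥ 0` on `[0,s]` (integrating factor `e^{∫q}`, no sign condition on `q`);
* `sideBranch_chain_zero_nonneg` — `x_0(0) ≥ 0 ⇒ x_0 ≥ 0` (`ẋ_0 = −(Λ_0 x_1 + Λ_0 s_0/5 + ν)x_0`);
* `sideBranch_side_zero_nonneg` — `s_0(0) ≥ 0 ⇒ s_0 ≥ 0` (`ṡ_0 = (1/5)Λ_0 x_0² − ((1/5)Λ_0 z_1 + ν)s_0`).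

HONEST FRAMING: elementary real analysis of a Tao-type MODEL lattice ODE (route SubOnsagerCeiling, rung
TL-M2Break); a brick toward a construction NOT carried out here; nothing bears on Navier–Stokes
regularity; no crux is settled here. [cite: Tao2016AveragedNS, §4 (4.2)–(4.3)]
-/

noncomputable section

-- the sub-problem namespace `NavierStokesRegularity.NavierStokesRegularity` is the tree's layout (D-0017)
set_option linter.dupNamespace false

namespace Summit.NavierStokesRegularity.NavierStokesRegularity.Theorems.SubOnsagerCeiling

open Set MeasureTheory intervalIntegral
open Literature.Analysis.FluidPDE.TaoCascade

/-- **Linear sign preservation.** If `y' = f = p − q·y` within `[0,s]` with `p ≥ 0` on `[0,s]`, `q`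
continuous and `y(0) ≥ 0`, then `y ≥ 0` on `[0,s]` (the integrating factor `u ↦ y(u)·e^{∫₀ᵘ q}` is
non-decreasing). [folklore] -/
theorem sideBranch_linear_sign {y f p q : ℝ → ℝ} {s : ℝ} (hq : Continuous q)
    (hy : ∀ u ∈ Icc (0 : ℝ) s, HasDerivWithinAt y (f u) (Icc 0 s) u)
    (hf : ∀ u ∈ Icc (0 : ℝ) s, f u = p u - q u * y u) (hp : ∀ u ∈ Icc (0 : ℝ) s, 0 ≤ p u)
    (hy0 : 0 ≤ y 0) {t : ℝ} (ht : t ∈ Icc (0 : ℝ) s) : 0 ≤ y t := by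
  set Q : ℝ → ℝ := fun u => ∫ x in (0 : ℝ)..u, q x with hQ
  set Φ : ℝ → ℝ := fun u => y u * Real.exp (Q u) with hΦ
  have hderΦ : ∀ u ∈ Icc (0 : ℝ) s, HasDerivWithinAt Φ (p u * Real.exp (Q u)) (Icc 0 s) u := by
    intro u hu
    have h1 : HasDerivWithinAt Q (q u) (Icc 0 s) u :=
      ((hq.integral_hasStrictDerivAt 0 u).hasDerivAt).hasDerivWithinAt
    have h2 : HasDerivWithinAt (fun x => Real.exp (Q x)) (Real.exp (Q u) * q u) (Icc 0 s) u := h1.exp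
    refine ((hy u hu).mul h2).congr_deriv ?_
    rw [hf u hu]
    ring
  have hnn : ∀ u ∈ Icc (0 : ℝ) s, 0 ≤ p u * Real.exp (Q u) := fun u hu =>
    mul_nonneg (hp u hu) (Real.exp_pos _).le
  have h := sideBranch_le_of_deriv_nonneg hderΦ hnn ht
  simp only [hΦ, hQ, integral_same, Real.exp_zero, mul_one] at h
  have hE : 0 < Real.exp (∫ x in (0 : ℝ)..t, q x) := Real.exp_pos _
  nlinarith

section Solution

variable {ε₀ ν s : ℝ} {X : Fin 4 → ℤ → ℝ → ℝ}

/-- **The chain mode on the datum shell keeps its sign**: `x_0(0) ≥ 0 ⇒ x_0 ≥ 0` on `[0,s]`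
(`ẋ_0 = −(Λ_0 x_1 + (1/5)Λ_0 s_0 + ν)·x_0`, nothing below shell `0`). [this file] -/
theorem sideBranch_chain_zero_nonneg (hlow : ∀ (i : Fin 4) (k : ℤ), k < 0 → ∀ t : ℝ, X i k t = 0)
    (hcont : ∀ (i : Fin 4) (k : ℤ), Continuous (X i k))
    (hder : ∀ (i : Fin 4) (k : ℤ), ∀ t ∈ Icc (0 : ℝ) s, HasDerivWithinAt (X i k)
      (quadTerm ε₀ sideBranchTable X i k t - ν * (1 + ε₀) ^ ((2 : ℝ) * k) * X i k t)
      (Icc (0 : ℝ) s) t)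
    (h0 : 0 ≤ X 0 0 0) {t : ℝ} (ht : t ∈ Icc (0 : ℝ) s) : 0 ≤ X 0 0 t := by
  have hq : Continuous fun u => (1 + ε₀) ^ ((5 : ℝ) * ((0 : ℤ) : ℝ) / 2) * X 0 (0 + 1) u +
      (1 / 5 : ℝ) * (1 + ε₀) ^ ((5 : ℝ) * ((0 : ℤ) : ℝ) / 2) * X 1 0 u +
      ν * (1 + ε₀) ^ ((2 : ℝ) * ((0 : ℤ) : ℝ)) := by
    have := hcont 0 (0 + 1); have := hcont 1 0; fun_prop
  refine sideBranch_linear_sign (p := fun _ => 0) hq (hder 0 0) (fun u _ => ?_) (fun u _ => le_rfl) h0 ht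
  rw [sideBranch_quadTerm_zero]
  have hx : X 0 (0 - 1) u = 0 := hlow 0 (0 - 1) (by norm_num) u
  rw [hx]
  push_cast
  ring

/-- **The side mode on the datum shell keeps its sign**: `s_0(0) ≥ 0 ⇒ s_0 ≥ 0` on `[0,s]`
(`ṡ_0 = (1/5)Λ_0 x_0² − ((1/5)Λ_0 z_1 + ν)·s_0`, source `≥ 0`). [this file] -/
theorem sideBranch_side_zero_nonneg (hε : 0 < ε₀) (hcont : ∀ (i : Fin 4) (k : ℤ), Continuous (X i k))
    (hder : ∀ (i : Fin 4) (k : ℤ), ∀ t ∈ Icc (0 : ℝ) s, HasDerivWithinAt (X i k)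
      (quadTerm ε₀ sideBranchTable X i k t - ν * (1 + ε₀) ^ ((2 : ℝ) * k) * X i k t)
      (Icc (0 : ℝ) s) t)
    (h0 : 0 ≤ X 1 0 0) {t : ℝ} (ht : t ∈ Icc (0 : ℝ) s) : 0 ≤ X 1 0 t := by
  have hb : (0 : ℝ) < 1 + ε₀ := by linarith
  have hq : Continuous fun u => (1 / 5 : ℝ) * (1 + ε₀) ^ ((5 : ℝ) * ((0 : ℤ) : ℝ) / 2) * X 2 (0 + 1) u +
      ν * (1 + ε₀) ^ ((2 : ℝ) * ((0 : ℤ) : ℝ)) := by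
    have := hcont 2 (0 + 1); fun_prop
  refine sideBranch_linear_sign
    (p := fun u => (1 / 5 : ℝ) * (1 + ε₀) ^ ((5 : ℝ) * ((0 : ℤ) : ℝ) / 2) * X 0 0 u ^ 2) hq (hder 1 0)
    (fun u _ => ?_) (fun u _ => ?_) h0 ht
  · rw [sideBranch_quadTerm_one]
    push_cast
    ring
  · have : 0 ≤ (1 + ε₀) ^ ((5 : ℝ) * ((0 : ℤ) : ℝ) / 2) := Real.rpow_nonneg hb.le _
    positivity

end Solution

end Summit.NavierStokesRegularity.NavierStokesRegularity.Theorems.SubOnsagerCeiling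

end
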